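import Literature.NumberTheory.DiophantineGeometry.MultiplicativeGroupApproximationOfMatveevYu
import Literature.NumberTheory.DiophantineGeometry.ApproximationBoundRat
import HarnessLib

/-!
# The two HALVES of the library rung «A1.L» over `ℚ`, each from ONE printed theorem:
# `archApproximationBound_rat` ⇐ Matveev 2000 (Cor. 2.3 over `ℚ`) alone, and
# `padicApproximationBound_rat` ⇐ Yu 2007 (over `ℚ`) alone

Topic `NumberTheory/DiophantineGeometry`; namespace `Literature.NumberTheory.DiophantineGeometry.Dioph`.
Proof-only companion (no definitions, no named facts) of `ApproximationBoundRat.lean` (the sub-rungs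
«A1.L(∞)» = `archApproximationBound_rat` and «A1.L(p)» = `padicApproximationBound_rat` of the
general-`α` library rung `approximationBound_rat`, cell abc-stewartyu / director-abc ruling N7) and of
`MultiplicativeGroupApproximation{Reduction,Thm328}Proofs.lean`,
`MultiplicativeGroupApproximationOfMatveevYu.lean` (Evertse–Győry Thm. 4.2.1 over `ℚ` from Matveev AND
Yu: `evertseGyory_thm_4_2_1_rat_holds_of`).

The printed derivation Thm. 3.2.8 ⇒ Thm. 4.2.1 (Evertse–Győry 2015, §4.4.2, pp. 80–81: height-minimal
system, small exponents from Prop. 4.4.1, Case A = Thm. 3.2.8, Case B = Liouville) and the passage to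
Pasten's Thm. 2.1 shape (`pasten2024_thm_2_1`) both run PLACE BY PLACE; the tree's versions were stated
for the conjunction of all places. This file re-runs them for each half separately —
`eg421_rat_arch_of_thm328_arch`, `eg421_rat_padic_of_thm328_padic` (verbatim the two branches of
`evertseGyory_thm_4_2_1_rat_of_thm_3_2_8`), `pastenArch_of_eg421_arch`, `pastenPadic_of_eg421_padic`
(the two branches of `pasten2024_thm_2_1`) — and concludes:

* `archApproximationBound_rat_of_matveev : matveev2000_linearFormsLog_rat → archApproximationBound_rat`
  («A1.L(∞)» hangs off Matveev's Cor. 2.3 over `ℚ` ALONE, through `thm328_rat_infinite_of_matveev`);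
* `padicApproximationBound_rat_of_yu2007 : yu2007_padicLogForm_rat → padicApproximationBound_rat`
  («A1.L(p)» hangs off Yu's theorem over `ℚ` ALONE, through `thm328_rat_finite_of_yu`).

So the trust roots of the two sub-rungs are separated: a kernel proof of Yu's theorem over `ℚ` (or of the
stronger general-`α` `p`-adic engine the cell abc-stewartyu plans as WP-L.P) closes «A1.L(p)» without any
archimedean input, and conversely. Net debt 0. WHAT THIS IS NOT: no linear-forms estimate is proved here;
nothing about the cruxes `Y07Odd`/`Y07Two` (primes-only texts do not give the general-`α` halves).

## References

* [EvertseGyory2015] J.-H. Evertse, K. Győry, *Unit Equations in Diophantine Number Theory*, CUP 2015 —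
  Thm 3.2.4 (p. 61), Thm 3.2.7 (p. 62), Thm 3.2.8 (p. 62) and proof (p. 63), Thm 4.2.1 (p. 68), §4.4.2
  (pp. 80–81).
* [Pasten2024] H. Pasten, *The largest prime factor of n² + 1 and improvements on subexponential ABC*,
  Invent. Math. 236 (2024) — Theorem 2.1 (i), (ii) (d = 1).
* [Matveev2000] E. M. Matveev, Izv. Math. 64 (2000) 1217–1269 — Cor. 2.3.
* [Yu2007] K. Yu, Forum Math. 19 (2007) 187–280 — Main Theorem, second consequence.
-/

open Height Real Finset Module

noncomputable section

namespace Literature.NumberTheory.DiophantineGeometry.Dioph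

/-! ### Evertse–Győry Thm. 4.2.1 over `ℚ`, archimedean clause, from the archimedean clause of Thm. 3.2.8 -/

/-- **Theorem 4.2.1 over `ℚ`, ARCHIMEDEAN CLAUSE, from the archimedean clause of Theorem 3.2.8 over
`ℚ`** (verbatim the `v = ∞` branch of `evertseGyory_thm_4_2_1_rat_of_thm_3_2_8`: small exponents by
Prop. 4.4.1 `exists_small_exponents`; Case A = `h328A` + `eg421_caseA_bound`; Case B = Liouville
`liouville_infinite` + `eg421_caseB_bound`). [cite: EvertseGyory2015, Thm 4.2.1 (p. 68), proof pp. 80–81, v infinite] -/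
theorem eg421_rat_arch_of_thm328_arch
    (h328A : ∀ (ι : Type) [Fintype ι], 0 < Fintype.card ι →
      ∀ α : ι → ℚ, (∀ i, α i ≠ 0 ∧ α i ≠ 1 ∧ α i ≠ -1) →
      ∀ β : ℚ, β ≠ 0 → ∀ s : ℤ, (s = 1 ∨ s = -1) → ∀ b : ι → ℤ,
        (∏ i, α i ^ b i) * β ^ s - 1 ≠ 0 →
      ∀ B : ℝ, (∀ i, (|b i| : ℝ) ≤ B) →
        2 * Real.exp 1 * 9 ^ (Fintype.card ι + 1) * (∏ i, logHeight₁ (α i)) *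
            max (logHeight₁ β) 1 ≤ B →
        -(egC6 (Fintype.card ι + 1) * (2 / Real.log 2) * (∏ i, logHeight₁ (α i)) *
              max (logHeight₁ β) 1 * logStar (B * 2 / max (logHeight₁ β) 1)) <
            Real.log |(((∏ i, α i ^ b i) * β ^ s - 1 : ℚ) : ℝ)|) :
    ∀ (ι : Type) [Fintype ι], 0 < Fintype.card ι →
    ∀ ξ : ι → ℚ, (∀ i, ξ i ≠ 0 ∧ ξ i ≠ 1 ∧ ξ i ≠ -1) →
    ∀ α : ℚ, α ≠ 0 → ∀ ζ : ℚ, (ζ = 1 ∨ ζ = -1) → ∀ b : ι → ℤ,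
      α * (ζ * ∏ i, ξ i ^ b i) ≠ 1 →
      -(egC8 (Fintype.card ι) * (2 / Real.log 2) * (∏ i, logHeight₁ (ξ i)) *
            max (logHeight₁ α) 1 *
            logStar (2 * logHeight₁ (ζ * ∏ i, ξ i ^ b i) / max (logHeight₁ α) 1)) <
          Real.log |((1 - α * (ζ * ∏ i, ξ i ^ b i) : ℚ) : ℝ)| := by
  intro ι _ hι ξ hξ α hα ζ hζ b hne
  obtain ⟨ξ', ζ', b', hξ', hζ', hxeq, hΘle, hb'⟩ := exists_small_exponents hι ξ hξ ζ hζ b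
  set m := Fintype.card ι with hm
  have hm1 : 1 ≤ m := hι
  set x : ℚ := ζ * ∏ i, ξ i ^ b i with hx
  set Θ := ∏ i, logHeight₁ (ξ i) with hΘ
  set Θ' := ∏ i, logHeight₁ (ξ' i) with hΘ'
  set H := max (logHeight₁ α) 1 with hH
  have hH1 : 1 ≤ H := le_max_right _ _
  have hH0 : 0 < H := by linarith
  have hlog2 : 0 < Real.log 2 := Real.log_pos one_lt_two
  have hΘ'pos : 0 < Θ' := by
    apply Finset.prod_pos; intro i _
    exact lt_of_lt_of_le hlog2 (log_two_le_logHeight₁ (hξ' i).1 (hξ' i).2.1 (hξ' i).2.2)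
  have hΘlow : Real.log 2 ^ m ≤ Θ := by
    have : ∏ _i : ι, Real.log 2 = Real.log 2 ^ m := by rw [Finset.prod_const, Finset.card_univ]
    rw [← this]
    exact Finset.prod_le_prod (fun i _ => hlog2.le) fun i _ =>
      log_two_le_logHeight₁ (hξ i).1 (hξ i).2.1 (hξ i).2.2
  have hhx : 0 ≤ logHeight₁ x := zero_le_logHeight₁ _
  -- c₁₇' and B
  set c : ℝ := (m : ℝ) ^ (2 * m) / Real.log 2 with hc
  set B : ℝ := c * logHeight₁ x with hB
  have hBb : ∀ i, (|b' i| : ℝ) ≤ B := by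
    intro i
    calc (|b' i| : ℝ) ≤ (m : ℝ) ^ (2 * m) * logHeight₁ x / Real.log 2 := hb' i
      _ = B := by rw [hB, hc]; ring
  -- N(v)/log N(v) ≥ e
  have hk2 : Real.exp 1 ≤ 2 / Real.log 2 := exp_one_le_div_log one_lt_two
  have hkp : ∀ p : ℕ, p.Prime → Real.exp 1 ≤ p / Real.log p := fun p hp =>
    exp_one_le_div_log (by exact_mod_cast hp.one_lt)
  have he0 : 0 < Real.exp 1 := Real.exp_pos 1
  by_cases hcase : 2 * Real.exp 1 * 9 ^ (m + 1) * Θ' * H ≤ B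
  · -- Case A: Theorem 3.2.8 with α := ξ', β := ζ' α, s := 1, b := b', B
    have hζ'0 : ζ' ≠ 0 := by rcases hζ' with rfl | rfl <;> norm_num
    have hβ : ζ' * α ≠ 0 := mul_ne_zero hζ'0 hα
    have hΛeq : (∏ i, ξ' i ^ b' i) * (ζ' * α) ^ (1 : ℤ) - 1 = -(1 - α * x) := by
      rw [zpow_one, hxeq]; ring
    have hΛ : (∏ i, ξ' i ^ b' i) * (ζ' * α) ^ (1 : ℤ) - 1 ≠ 0 := by
      rw [hΛeq, neg_ne_zero, sub_ne_zero]; exact Ne.symm hne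
    have hHβ : max (logHeight₁ (ζ' * α)) 1 = H := by
      rcases hζ' with rfl | rfl
      · rw [one_mul]
      · rw [neg_one_mul, logHeight₁_neg]
    have hB' : 2 * Real.exp 1 * 9 ^ (Fintype.card ι + 1) * (∏ i, logHeight₁ (ξ' i)) *
        max (logHeight₁ (ζ' * α)) 1 ≤ B := by rw [hHβ]; exact hcase
    have hA := h328A ι hι ξ' hξ' (ζ' * α) hβ 1 (Or.inl rfl) b' hΛ B hBb hB'
    rw [hHβ, hΛeq] at hA
    have habs : |((-(1 - α * x) : ℚ) : ℝ)| = |((1 - α * x : ℚ) : ℝ)| := by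
      push_cast; rw [abs_neg]
    rw [habs] at hA
    have hkey := eg421_caseA_bound m (k := 2 / Real.log 2) (Nv := 2) hΘle hΘ'pos.le hH1 hhx
      zero_le_two (by positivity)
    have heq : (m : ℝ) ^ (2 * m) / Real.log 2 * logHeight₁ x * 2 / H = B * 2 / H := by
      rw [hB, hc]
    rw [heq] at hkey
    linarith
  · -- Case B: Liouville
    push Not at hcase
    have hy : α * x ≠ 1 := hne
    have hhy : logHeight₁ (α * x) ≤ H + logHeight₁ x :=
      le_trans (logHeight₁_mul_le α x) (by linarith [le_max_left (logHeight₁ α) 1])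
    -- h(x) < 2e 9^{m+1} Θ' H / c ≤ 2e 9^{m+1} Θ H
    have hcpos : 0 < c := by
      rw [hc]
      have : (0 : ℝ) < m := by exact_mod_cast hm1
      positivity
    have hcinv : 1 / c ≤ 1 := by
      rw [hc, one_div_div]
      have hl2' : Real.log 2 ≤ 1 := by
        have := Real.log_two_lt_d9; linarith
      have hmm : (1 : ℝ) ≤ (m : ℝ) ^ (2 * m) := one_le_pow₀ (by exact_mod_cast hm1)
      calc Real.log 2 / (m : ℝ) ^ (2 * m) ≤ Real.log 2 / 1 :=
            div_le_div_of_nonneg_left hlog2.le one_pos hmm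
        _ ≤ 1 := by rw [div_one]; exact hl2'
    have hxlt : logHeight₁ x < 2 * Real.exp 1 * 9 ^ (m + 1) * Θ * H := by
      have h1 : logHeight₁ x = B * (1 / c) := by
        rw [hB]; field_simp
      have h2 : B * (1 / c) < (2 * Real.exp 1 * 9 ^ (m + 1) * Θ' * H) * (1 / c) :=
        mul_lt_mul_of_pos_right hcase (by positivity)
      have h3 : (2 * Real.exp 1 * 9 ^ (m + 1) * Θ' * H) * (1 / c) ≤
          (2 * Real.exp 1 * 9 ^ (m + 1) * Θ' * H) * 1 :=
        mul_le_mul_of_nonneg_left hcinv (by positivity)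
      have h4 : 2 * Real.exp 1 * 9 ^ (m + 1) * Θ' * H ≤ 2 * Real.exp 1 * 9 ^ (m + 1) * Θ * H := by
        apply mul_le_mul_of_nonneg_right _ hH0.le
        exact mul_le_mul_of_nonneg_left hΘle (by positivity)
      linarith
    have ht : Real.log 2 + logHeight₁ (α * x) <
        Real.log 2 + H + 2 * Real.exp 1 * 9 ^ (m + 1) * Θ * H := by linarith
    have h1 := liouville_infinite hy
    have h2 := eg421_caseB_bound m hm1 (k := 2 / Real.log 2)
      (L := logStar (2 * logHeight₁ x / H)) hΘlow hH1 hk2 (one_le_logStar _) ht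
    linarith


/-! ### Evertse–Győry Thm. 4.2.1 over `ℚ`, `p`-adic clauses, from the `p`-adic clauses of Thm. 3.2.8 -/

/-- **Theorem 4.2.1 over `ℚ`, `p`-ADIC CLAUSES, from the `p`-adic clauses of Theorem 3.2.8 over `ℚ`**
(verbatim the finite-place branch of `evertseGyory_thm_4_2_1_rat_of_thm_3_2_8`: Case A = `h328F` +
`eg421_caseA_bound`; Case B = `liouville_finite` + `eg421_caseB_bound`).
[cite: EvertseGyory2015, Thm 4.2.1 (p. 68), proof pp. 80–81, v finite] -/
theorem eg421_rat_padic_of_thm328_padic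
    (h328F : ∀ (ι : Type) [Fintype ι], 0 < Fintype.card ι →
      ∀ α : ι → ℚ, (∀ i, α i ≠ 0 ∧ α i ≠ 1 ∧ α i ≠ -1) →
      ∀ β : ℚ, β ≠ 0 → ∀ s : ℤ, (s = 1 ∨ s = -1) → ∀ b : ι → ℤ,
        (∏ i, α i ^ b i) * β ^ s - 1 ≠ 0 →
      ∀ B : ℝ, (∀ i, (|b i| : ℝ) ≤ B) →
        2 * Real.exp 1 * 9 ^ (Fintype.card ι + 1) * (∏ i, logHeight₁ (α i)) *
            max (logHeight₁ β) 1 ≤ B →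
        ∀ p : ℕ, p.Prime →
          -(egC6 (Fintype.card ι + 1) * (p / Real.log p) * (∏ i, logHeight₁ (α i)) *
              max (logHeight₁ β) 1 * logStar (B * p / max (logHeight₁ β) 1)) <
            -(padicValRat p ((∏ i, α i ^ b i) * β ^ s - 1) : ℝ) * Real.log p) :
    ∀ (ι : Type) [Fintype ι], 0 < Fintype.card ι →
    ∀ ξ : ι → ℚ, (∀ i, ξ i ≠ 0 ∧ ξ i ≠ 1 ∧ ξ i ≠ -1) →
    ∀ α : ℚ, α ≠ 0 → ∀ ζ : ℚ, (ζ = 1 ∨ ζ = -1) → ∀ b : ι → ℤ,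
      α * (ζ * ∏ i, ξ i ^ b i) ≠ 1 →
      ∀ p : ℕ, p.Prime →
        -(egC8 (Fintype.card ι) * (p / Real.log p) * (∏ i, logHeight₁ (ξ i)) *
            max (logHeight₁ α) 1 *
            logStar (p * logHeight₁ (ζ * ∏ i, ξ i ^ b i) / max (logHeight₁ α) 1)) <
          -(padicValRat p (1 - α * (ζ * ∏ i, ξ i ^ b i)) : ℝ) * Real.log p := by
  intro ι _ hι ξ hξ α hα ζ hζ b hne
  obtain ⟨ξ', ζ', b', hξ', hζ', hxeq, hΘle, hb'⟩ := exists_small_exponents hι ξ hξ ζ hζ b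
  set m := Fintype.card ι with hm
  have hm1 : 1 ≤ m := hι
  set x : ℚ := ζ * ∏ i, ξ i ^ b i with hx
  set Θ := ∏ i, logHeight₁ (ξ i) with hΘ
  set Θ' := ∏ i, logHeight₁ (ξ' i) with hΘ'
  set H := max (logHeight₁ α) 1 with hH
  have hH1 : 1 ≤ H := le_max_right _ _
  have hH0 : 0 < H := by linarith
  have hlog2 : 0 < Real.log 2 := Real.log_pos one_lt_two
  have hΘ'pos : 0 < Θ' := by
    apply Finset.prod_pos; intro i _
    exact lt_of_lt_of_le hlog2 (log_two_le_logHeight₁ (hξ' i).1 (hξ' i).2.1 (hξ' i).2.2)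
  have hΘlow : Real.log 2 ^ m ≤ Θ := by
    have : ∏ _i : ι, Real.log 2 = Real.log 2 ^ m := by rw [Finset.prod_const, Finset.card_univ]
    rw [← this]
    exact Finset.prod_le_prod (fun i _ => hlog2.le) fun i _ =>
      log_two_le_logHeight₁ (hξ i).1 (hξ i).2.1 (hξ i).2.2
  have hhx : 0 ≤ logHeight₁ x := zero_le_logHeight₁ _
  -- c₁₇' and B
  set c : ℝ := (m : ℝ) ^ (2 * m) / Real.log 2 with hc
  set B : ℝ := c * logHeight₁ x with hB
  have hBb : ∀ i, (|b' i| : ℝ) ≤ B := by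
    intro i
    calc (|b' i| : ℝ) ≤ (m : ℝ) ^ (2 * m) * logHeight₁ x / Real.log 2 := hb' i
      _ = B := by rw [hB, hc]; ring
  -- N(v)/log N(v) ≥ e
  have hk2 : Real.exp 1 ≤ 2 / Real.log 2 := exp_one_le_div_log one_lt_two
  have hkp : ∀ p : ℕ, p.Prime → Real.exp 1 ≤ p / Real.log p := fun p hp =>
    exp_one_le_div_log (by exact_mod_cast hp.one_lt)
  have he0 : 0 < Real.exp 1 := Real.exp_pos 1
  by_cases hcase : 2 * Real.exp 1 * 9 ^ (m + 1) * Θ' * H ≤ B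
  · -- Case A: Theorem 3.2.8 with α := ξ', β := ζ' α, s := 1, b := b', B
    have hζ'0 : ζ' ≠ 0 := by rcases hζ' with rfl | rfl <;> norm_num
    have hβ : ζ' * α ≠ 0 := mul_ne_zero hζ'0 hα
    have hΛeq : (∏ i, ξ' i ^ b' i) * (ζ' * α) ^ (1 : ℤ) - 1 = -(1 - α * x) := by
      rw [zpow_one, hxeq]; ring
    have hΛ : (∏ i, ξ' i ^ b' i) * (ζ' * α) ^ (1 : ℤ) - 1 ≠ 0 := by
      rw [hΛeq, neg_ne_zero, sub_ne_zero]; exact Ne.symm hne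
    have hHβ : max (logHeight₁ (ζ' * α)) 1 = H := by
      rcases hζ' with rfl | rfl
      · rw [one_mul]
      · rw [neg_one_mul, logHeight₁_neg]
    have hB' : 2 * Real.exp 1 * 9 ^ (Fintype.card ι + 1) * (∏ i, logHeight₁ (ξ' i)) *
        max (logHeight₁ (ζ' * α)) 1 ≤ B := by rw [hHβ]; exact hcase
    intro p hp
    have hF := h328F ι hι ξ' hξ' (ζ' * α) hβ 1 (Or.inl rfl) b' hΛ B hBb hB' p hp
    rw [hHβ, hΛeq] at hF
    have hFp := hF
    rw [padicValRat.neg] at hFp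
    have hp0 : (0 : ℝ) ≤ p := Nat.cast_nonneg p
    have hkey := eg421_caseA_bound m (k := p / Real.log p) (Nv := p) hΘle hΘ'pos.le hH1 hhx hp0
      (le_trans he0.le (hkp p hp))
    have heq : (m : ℝ) ^ (2 * m) / Real.log 2 * logHeight₁ x * p / H = B * p / H := by
      rw [hB, hc]
    rw [heq] at hkey
    linarith
  · -- Case B: Liouville
    push Not at hcase
    have hy : α * x ≠ 1 := hne
    have hhy : logHeight₁ (α * x) ≤ H + logHeight₁ x :=
      le_trans (logHeight₁_mul_le α x) (by linarith [le_max_left (logHeight₁ α) 1])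
    -- h(x) < 2e 9^{m+1} Θ' H / c ≤ 2e 9^{m+1} Θ H
    have hcpos : 0 < c := by
      rw [hc]
      have : (0 : ℝ) < m := by exact_mod_cast hm1
      positivity
    have hcinv : 1 / c ≤ 1 := by
      rw [hc, one_div_div]
      have hl2' : Real.log 2 ≤ 1 := by
        have := Real.log_two_lt_d9; linarith
      have hmm : (1 : ℝ) ≤ (m : ℝ) ^ (2 * m) := one_le_pow₀ (by exact_mod_cast hm1)
      calc Real.log 2 / (m : ℝ) ^ (2 * m) ≤ Real.log 2 / 1 :=
            div_le_div_of_nonneg_left hlog2.le one_pos hmm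
        _ ≤ 1 := by rw [div_one]; exact hl2'
    have hxlt : logHeight₁ x < 2 * Real.exp 1 * 9 ^ (m + 1) * Θ * H := by
      have h1 : logHeight₁ x = B * (1 / c) := by
        rw [hB]; field_simp
      have h2 : B * (1 / c) < (2 * Real.exp 1 * 9 ^ (m + 1) * Θ' * H) * (1 / c) :=
        mul_lt_mul_of_pos_right hcase (by positivity)
      have h3 : (2 * Real.exp 1 * 9 ^ (m + 1) * Θ' * H) * (1 / c) ≤
          (2 * Real.exp 1 * 9 ^ (m + 1) * Θ' * H) * 1 :=
        mul_le_mul_of_nonneg_left hcinv (by positivity)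
      have h4 : 2 * Real.exp 1 * 9 ^ (m + 1) * Θ' * H ≤ 2 * Real.exp 1 * 9 ^ (m + 1) * Θ * H := by
        apply mul_le_mul_of_nonneg_right _ hH0.le
        exact mul_le_mul_of_nonneg_left hΘle (by positivity)
      linarith
    have ht : Real.log 2 + logHeight₁ (α * x) <
        Real.log 2 + H + 2 * Real.exp 1 * 9 ^ (m + 1) * Θ * H := by linarith
    intro p hp
    have h1 := liouville_finite hy p hp
    have h2 := eg421_caseB_bound m hm1 (k := p / Real.log p)
      (L := logStar (p * logHeight₁ x / H)) hΘlow hH1 (hkp p hp) (one_le_logStar _) ht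
    linarith


/-! ### Pasten's shape, place by place -/

/-- **Pasten 2024 Thm. 2.1 (i) over `ℚ` (archimedean clause, `K = pastenK`) from the archimedean clause
of Evertse–Győry Thm. 4.2.1 over `ℚ`** (the `v = ∞` branch of `pasten2024_thm_2_1`: `α = 1`, `H = 1`,
`(2/log 2)·log*(2h) ≤ 5·log max{e, h}`, `5·c₈(m) ≤ K^m`). [cite: Pasten2024, Theorem 2.1 (i) (d = 1)] -/
theorem pastenArch_of_eg421_arch
    (h : ∀ (ι : Type) [Fintype ι], 0 < Fintype.card ι →
      ∀ ξ : ι → ℚ, (∀ i, ξ i ≠ 0 ∧ ξ i ≠ 1 ∧ ξ i ≠ -1) →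
      ∀ α : ℚ, α ≠ 0 → ∀ ζ : ℚ, (ζ = 1 ∨ ζ = -1) → ∀ b : ι → ℤ,
        α * (ζ * ∏ i, ξ i ^ b i) ≠ 1 →
        -(egC8 (Fintype.card ι) * (2 / Real.log 2) * (∏ i, logHeight₁ (ξ i)) *
              max (logHeight₁ α) 1 *
              logStar (2 * logHeight₁ (ζ * ∏ i, ξ i ^ b i) / max (logHeight₁ α) 1)) <
            Real.log |((1 - α * (ζ * ∏ i, ξ i ^ b i) : ℚ) : ℝ)|) :
    ∀ (ι : Type) [Fintype ι], 0 < Fintype.card ι → ∀ ξ : ι → ℚ,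
    (∀ i, ξ i ≠ 0 ∧ ξ i ≠ 1 ∧ ξ i ≠ -1) → ∀ ζ : ℚ, (ζ = 1 ∨ ζ = -1) → ∀ b : ι → ℤ,
    ζ * ∏ i, ξ i ^ b i ≠ 1 →
      -Real.log |((1 - ζ * ∏ i, ξ i ^ b i : ℚ) : ℝ)| <
        pastenK ^ Fintype.card ι *
          Real.log (max (Real.exp 1) (logHeight₁ (ζ * ∏ i, ξ i ^ b i))) *
          ∏ i, logHeight₁ (ξ i) := by
  intro ι _ hι ξ hξ ζ hζ b hx
  set x : ℚ := ζ * ∏ i, ξ i ^ b i with hxdef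
  have hx1 : (1 : ℚ) * x ≠ 1 := by rwa [one_mul]
  have hA := h ι hι ξ hξ 1 one_ne_zero ζ hζ b hx1
  have hH : max (logHeight₁ (1 : ℚ)) 1 = 1 := by rw [logHeight₁_one, max_eq_right zero_le_one]
  simp only [hH, mul_one, div_one, one_mul] at hA
  have hΘ : 0 ≤ ∏ i, logHeight₁ (ξ i) := Finset.prod_nonneg fun i _ => zero_le_logHeight₁ _
  have hhx : 0 ≤ logHeight₁ x := zero_le_logHeight₁ _
  have hK : 5 * egC8 (Fintype.card ι) ≤ pastenK ^ Fintype.card ι := five_mul_egC8_le _ hι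
  have hc8 : 0 ≤ egC8 (Fintype.card ι) := by
    rw [egC8_def]
    have : (0 : ℝ) ≤ (if Fintype.card ι = 1 then (12 : ℝ) else 1) := by split_ifs <;> norm_num
    have h16 : (0 : ℝ) ≤ 16 * Real.exp 1 := by positivity
    have hm : (0 : ℝ) ≤ max 1 (Real.log (Fintype.card ι)) := le_trans zero_le_one (le_max_left _ _)
    positivity
  have hlogmax1 : ∀ u : ℝ, 1 ≤ Real.log (max (Real.exp 1) u) := fun u => by
    rw [← Real.log_exp 1]
    exact Real.log_le_log (Real.exp_pos 1) (by rw [Real.log_exp]; exact le_max_left _ _)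
  -- archimedean place
  have h2 : logStar (2 * logHeight₁ x) ≤
      (1 + Real.log 2) * Real.log (max (Real.exp 1) (logHeight₁ x)) := by
    rw [logStar_eq_log_max (by positivity)]
    have hm0 : 0 < max (Real.exp 1) (logHeight₁ x) := lt_max_of_lt_left (Real.exp_pos 1)
    have hle : max (Real.exp 1) (2 * logHeight₁ x) ≤ 2 * max (Real.exp 1) (logHeight₁ x) := by
      refine max_le ?_ ?_
      · linarith [le_max_left (Real.exp 1) (logHeight₁ x), Real.exp_pos 1]
      · linarith [le_max_right (Real.exp 1) (logHeight₁ x)]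
    calc Real.log (max (Real.exp 1) (2 * logHeight₁ x))
        ≤ Real.log (2 * max (Real.exp 1) (logHeight₁ x)) :=
          Real.log_le_log (lt_max_of_lt_left (Real.exp_pos 1)) hle
      _ = Real.log 2 + Real.log (max (Real.exp 1) (logHeight₁ x)) := by
          rw [Real.log_mul (by norm_num) hm0.ne']
      _ ≤ Real.log 2 * Real.log (max (Real.exp 1) (logHeight₁ x)) +
            Real.log (max (Real.exp 1) (logHeight₁ x)) := by
          have := hlogmax1 (logHeight₁ x)
          have hl2 : 0 ≤ Real.log 2 := Real.log_nonneg (by norm_num)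
          nlinarith
      _ = (1 + Real.log 2) * Real.log (max (Real.exp 1) (logHeight₁ x)) := by ring
  have hlog2 : 0 < Real.log 2 := Real.log_pos (by norm_num)
  calc -Real.log |((1 - x : ℚ) : ℝ)|
      < egC8 (Fintype.card ι) * (2 / Real.log 2) * (∏ i, logHeight₁ (ξ i)) *
          logStar (2 * logHeight₁ x) := by linarith
    _ ≤ egC8 (Fintype.card ι) * (2 / Real.log 2) * (∏ i, logHeight₁ (ξ i)) *
          ((1 + Real.log 2) * Real.log (max (Real.exp 1) (logHeight₁ x))) := by
        apply mul_le_mul_of_nonneg_left h2; positivity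
    _ = (2 / Real.log 2 * (1 + Real.log 2)) * egC8 (Fintype.card ι) *
          Real.log (max (Real.exp 1) (logHeight₁ x)) * ∏ i, logHeight₁ (ξ i) := by ring
    _ ≤ 5 * egC8 (Fintype.card ι) *
          Real.log (max (Real.exp 1) (logHeight₁ x)) * ∏ i, logHeight₁ (ξ i) := by
        have := two_div_log_two_mul_le
        have h1 := hlogmax1 (logHeight₁ x)
        apply mul_le_mul_of_nonneg_right _ hΘ
        apply mul_le_mul_of_nonneg_right _ (by linarith)
        exact mul_le_mul_of_nonneg_right this hc8
    _ ≤ pastenK ^ Fintype.card ι *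
          Real.log (max (Real.exp 1) (logHeight₁ x)) * ∏ i, logHeight₁ (ξ i) := by
        apply mul_le_mul_of_nonneg_right _ hΘ
        exact mul_le_mul_of_nonneg_right hK (by linarith [hlogmax1 (logHeight₁ x)])


/-- **Pasten 2024 Thm. 2.1 (ii) over `ℚ` (`p`-adic clauses, `K = pastenK`) from the `p`-adic clauses of
Evertse–Győry Thm. 4.2.1 over `ℚ`** (the finite-place branch of `pasten2024_thm_2_1`).
[cite: Pasten2024, Theorem 2.1 (ii) (d = 1)] -/
theorem pastenPadic_of_eg421_padic
    (h : ∀ (ι : Type) [Fintype ι], 0 < Fintype.card ι →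
      ∀ ξ : ι → ℚ, (∀ i, ξ i ≠ 0 ∧ ξ i ≠ 1 ∧ ξ i ≠ -1) →
      ∀ α : ℚ, α ≠ 0 → ∀ ζ : ℚ, (ζ = 1 ∨ ζ = -1) → ∀ b : ι → ℤ,
        α * (ζ * ∏ i, ξ i ^ b i) ≠ 1 →
        ∀ p : ℕ, p.Prime →
          -(egC8 (Fintype.card ι) * (p / Real.log p) * (∏ i, logHeight₁ (ξ i)) *
              max (logHeight₁ α) 1 *
              logStar (p * logHeight₁ (ζ * ∏ i, ξ i ^ b i) / max (logHeight₁ α) 1)) <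
            -(padicValRat p (1 - α * (ζ * ∏ i, ξ i ^ b i)) : ℝ) * Real.log p) :
    ∀ (ι : Type) [Fintype ι], 0 < Fintype.card ι → ∀ ξ : ι → ℚ,
    (∀ i, ξ i ≠ 0 ∧ ξ i ≠ 1 ∧ ξ i ≠ -1) → ∀ ζ : ℚ, (ζ = 1 ∨ ζ = -1) → ∀ b : ι → ℤ,
    ζ * ∏ i, ξ i ^ b i ≠ 1 → ∀ p : ℕ, p.Prime →
      (padicValRat p (1 - ζ * ∏ i, ξ i ^ b i) : ℝ) * Real.log p <
        pastenK ^ Fintype.card ι * (p / Real.log p) *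
          Real.log (max (Real.exp 1) (p * logHeight₁ (ζ * ∏ i, ξ i ^ b i))) *
          ∏ i, logHeight₁ (ξ i) := by
  intro ι _ hι ξ hξ ζ hζ b hx p hp
  set x : ℚ := ζ * ∏ i, ξ i ^ b i with hxdef
  have hx1 : (1 : ℚ) * x ≠ 1 := by rwa [one_mul]
  have hNp := h ι hι ξ hξ 1 one_ne_zero ζ hζ b hx1 p hp
  have hH : max (logHeight₁ (1 : ℚ)) 1 = 1 := by rw [logHeight₁_one, max_eq_right zero_le_one]
  simp only [hH, mul_one, div_one, one_mul] at hNp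
  have hΘ : 0 ≤ ∏ i, logHeight₁ (ξ i) := Finset.prod_nonneg fun i _ => zero_le_logHeight₁ _
  have hhx : 0 ≤ logHeight₁ x := zero_le_logHeight₁ _
  have hK : 5 * egC8 (Fintype.card ι) ≤ pastenK ^ Fintype.card ι := five_mul_egC8_le _ hι
  have hc8 : 0 ≤ egC8 (Fintype.card ι) := by
    rw [egC8_def]
    have : (0 : ℝ) ≤ (if Fintype.card ι = 1 then (12 : ℝ) else 1) := by split_ifs <;> norm_num
    have h16 : (0 : ℝ) ≤ 16 * Real.exp 1 := by positivity
    have hm : (0 : ℝ) ≤ max 1 (Real.log (Fintype.card ι)) := le_trans zero_le_one (le_max_left _ _)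
    positivity
  have hlogmax1 : ∀ u : ℝ, 1 ≤ Real.log (max (Real.exp 1) u) := fun u => by
    rw [← Real.log_exp 1]
    exact Real.log_le_log (Real.exp_pos 1) (by rw [Real.log_exp]; exact le_max_left _ _)
  -- finite place
  have hp0 : (0 : ℝ) < p := by exact_mod_cast hp.pos
  have hlogp : 0 < Real.log p := Real.log_pos (by exact_mod_cast hp.one_lt)
  rw [logStar_eq_log_max (by positivity)] at hNp
  calc (padicValRat p (1 - x) : ℝ) * Real.log p
      < egC8 (Fintype.card ι) * (p / Real.log p) * (∏ i, logHeight₁ (ξ i)) *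
          Real.log (max (Real.exp 1) (p * logHeight₁ x)) := by linarith
    _ = egC8 (Fintype.card ι) * ((p / Real.log p) *
          Real.log (max (Real.exp 1) (p * logHeight₁ x)) * ∏ i, logHeight₁ (ξ i)) := by ring
    _ ≤ pastenK ^ Fintype.card ι * ((p / Real.log p) *
          Real.log (max (Real.exp 1) (p * logHeight₁ x)) * ∏ i, logHeight₁ (ξ i)) := by
        apply mul_le_mul_of_nonneg_right (by linarith)
        have := hlogmax1 (p * logHeight₁ x)
        have : 0 ≤ p / Real.log p := by positivity
        positivity
    _ = _ := by ring

/-! ### The two sub-rungs from one printed theorem each -/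

/-- **«A1.L(∞)» from Matveev alone: `matveev2000_linearFormsLog_rat → archApproximationBound_rat`**
(Matveev 2000 Cor. 2.3 over `ℚ` ⇒ Thm. 3.2.8 over `ℚ` at `v = ∞` (`thm328_rat_infinite_of_matveev`,
p. 63) ⇒ Thm. 4.2.1 at `v = ∞` (pp. 80–81) ⇒ Pasten's clause (i) with `K = pastenK ≥ 1`). No `p`-adic
input. [cite: EvertseGyory2015, Thm 3.2.4 (p. 61), Thm 4.2.1 (p. 68)] [cite: Matveev2000, Cor. 2.3]
[cite: Pasten2024, Theorem 2.1 (i) (d = 1)] -/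
theorem archApproximationBound_rat_of_matveev (hM : matveev2000_linearFormsLog_rat) :
    archApproximationBound_rat := by
  have hP := pastenArch_of_eg421_arch
    (eg421_rat_arch_of_thm328_arch fun ι _ hι α hα β hβ s hs b hΛ B hbB hB =>
      thm328_rat_infinite_of_matveev hM ι hι α hα β hβ s hs b hΛ B hbB hB)
  refine ⟨pastenK, one_le_pastenK, fun ι _ hι ξ hξ ζ hζ b hx => ?_⟩
  have h1 := hP ι hι ξ hξ ζ hζ b hx
  have hc : ((1 - ζ * ∏ i, ξ i ^ b i : ℚ) : ℝ) = 1 - ((ζ * ∏ i, ξ i ^ b i : ℚ) : ℝ) := by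
    push_cast; ring
  rw [hc] at h1
  linarith

/-- **«A1.L(p)» from Yu alone: `yu2007_padicLogForm_rat → padicApproximationBound_rat`** (Yu 2007 over
`ℚ` ⇒ Thm. 3.2.8 over `ℚ` at the finite places (`thm328_rat_finite_of_yu`, p. 63) ⇒ Thm. 4.2.1 at the
finite places (pp. 80–81) ⇒ Pasten's clause (ii) with `K = pastenK ≥ 1`). No archimedean input.
[cite: EvertseGyory2015, Thm 3.2.7 (p. 62), Thm 4.2.1 (p. 68)] [cite: Yu2007, Main Thm, 2nd consequence]
[cite: Pasten2024, Theorem 2.1 (ii) (d = 1)] -/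
theorem padicApproximationBound_rat_of_yu2007 (hY : Literature.Barriers.ABC.yu2007_padicLogForm_rat) :
    padicApproximationBound_rat :=
  ⟨pastenK, one_le_pastenK, pastenPadic_of_eg421_padic
    (eg421_rat_padic_of_thm328_padic fun ι _ hι α hα β hβ s hs b hΛ B hbB hB p hp =>
      thm328_rat_finite_of_yu hY ι hι α hα β hβ s hs b hΛ B hbB hB p hp)⟩

/-- Sanity (assembly): the two one-source halves re-assemble the library rung from Matveev AND Yu, as
`approximationBound_rat_of_evertseGyory ∘ evertseGyory_thm_4_2_1_rat_holds_of` does.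
[cite: EvertseGyory2015, Thm 4.2.1 (p. 68)] -/
example (hM : matveev2000_linearFormsLog_rat) (hY : Literature.Barriers.ABC.yu2007_padicLogForm_rat) :
    approximationBound_rat :=
  approximationBound_rat_of_halves (archApproximationBound_rat_of_matveev hM)
    (padicApproximationBound_rat_of_yu2007 hY)

end Literature.NumberTheory.DiophantineGeometry.Dioph

end
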